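import Summits.AtomisticToContinuum.HydrodynamicLimit.Statement
import Summits.AtomisticToContinuum.FouriersLaw.Statement
import Summits.AtomisticToContinuum.Crystallization.Statement
import Summits.AtomisticToContinuum.BoseEinsteinCondensation.Statement
import Literature.MathematicalPhysics.KineticTheory.HardSphereEuler
import Literature.MathematicalPhysics.KineticTheory.FouriersLaw
import Literature.MathematicalPhysics.StatisticalMechanics.Crystallization
import Literature.MathematicalPhysics.QuantumManyBody.BoseEinsteinCondensation
import HarnessLib

/-!
# AtomisticToContinuum — problem statement (D-0013; operator-created)

`AtomisticToContinuum := HydrodynamicLimit ∧ FouriersLaw ∧ Crystallization ∧ BoseEinsteinCondensation`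
(docs/m5/PROBLEMS.md row 18, tier 2). Each conjunct is the Literature `def … : Prop` of the same
name, IMPORTED not restated — except `HydrodynamicLimit`, stated in its own registry file since the
re-type of 2026-08-16 (D-0032); this file only assembles them under the canonical root-level summit
name. One summit statement, no variants (D-0015 (3)).

Statement choice per conjunct (D-0015; audits 2026-08-13, docs/m5/AUDITS.md):

* `HydrodynamicLimit` — stated in the registry file `HydrodynamicLimit/Statement.lean` (statement
  re-type 2026-08-16, D-0032; formerly the unguarded `Literature.MathematicalPhysics.KineticTheory.HydrodynamicLimit`,
  which still implies it, `HydrodynamicLimit.of_unguarded`; verbatim the `d = 3` case of the Literature's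
  `HydroLimitInBandDim`, `hydroLimitInBandDim_three_iff_root`) — compressible Euler, up to
  the first shock (any classical existence time `T`), as the scaling limit of DETERMINISTIC Newtonian
  hard-sphere dynamics on `𝕋³` at FIXED POSITIVE reduced density `(N+1)ε³ = σ³` (no Boltzmann–Grad
  rescaling), with RANDOM local-Gibbs initial data and convergence IN PROBABILITY of the empirical
  density / momentum / energy fields, for classical solutions whose local packing fraction stays
  below a threshold; closure `∃ η₀ > 0, ∀ profiles, ∃ σ₀ > 0, ∀ σ ∈ (0, σ₀), ∀ T, ∀ solutions with
  ρ_t(x)σ³ < η₀ on [0, T)` (Spohn 1991, Part I Ch. 3; conclusion in the Olla–Varadhan–Yau 1993 §1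
  law-of-large-numbers form).
* `FouriersLaw` = `Literature.MathematicalPhysics.KineticTheory.HeatConduction.FouriersLaw` — Fourier's law for the pinned anharmonic chain
  between Langevin heat baths: `κ(T) = lim_N N · lim_{δT→0} J_N/δT` exists with `0 < κ(T) < ∞`
  (Bonetto–Lebowitz–Rey-Bellet 2000, §5.3 (33)); the model is fixed in the Literature file.
* `Crystallization` = `Literature.MathematicalPhysics.StatisticalMechanics.Crystallization` — Lennard-Jones `V(r) = r⁻¹²/12 - r⁻⁶/6` in
  `ℝ³`: (i) the ground-state energy per particle `E(N)/N` converges to the minimum of the energy per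
  particle over periodic (multi-lattice) configurations, the minimum being attained, AND (ii)
  (Blanc–Lewin 2015, §2.1 (15)–(18)) for every sequence of ground states, after extraction of a
  subsequence and up to TRANSLATIONS, the empirical measures converge locally to a non-zero
  lattice-periodic point measure. Which lattice (FCC/HCP/…) is not claimed.
* `BoseEinsteinCondensation` = `Literature.MathematicalPhysics.QuantumManyBody.BoseGas.BoseEinsteinCondensation` — 3-D continuum bosons with a
  repulsive finite-range radial pair potential, Dirichlet box, ground state, thermodynamic limit at
  fixed density `L = (N/ρ)^{1/3}`: `λ_max(γ⁽¹⁾) ≥ c N` for all large `N`, for every such `v` at all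
  sufficiently small densities, `∀ v, ∃ ρ₀(v) > 0, ∀ ρ ∈ (0, ρ₀), ∃ c > 0, ∀ᶠ N`
  (Lieb–Seiringer–Solovej–Yngvason 2005, §1.2 (1.16)–(1.19), Ch. 5 (5.1)–(5.2)).
-/

/-- **AtomisticToContinuum** (D-0013, tier 2; the single summit statement, D-0015): the passage
from atomistic Newtonian / quantum many-body models to continuum laws —
`HydrodynamicLimit ∧ FouriersLaw ∧ Crystallization ∧ BoseEinsteinCondensation` (packing-guarded
hydrodynamic limit of hard spheres at fixed density, Fourier's law for the pinned anharmonic chain, crystallization of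
Lennard-Jones ground states in `ℝ³`, Bose–Einstein condensation of the dilute Bose gas at fixed
density). [problem: hilbert6] -/
def AtomisticToContinuum : Prop :=
  HydrodynamicLimit ∧ FouriersLaw ∧ Crystallization ∧ BoseEinsteinCondensation

/-- Unfolding: the summit is the conjunction of the registry conjunct `HydrodynamicLimit` (= the
`d = 3` case of the Literature's `HydroLimitInBandDim`) and the three Literature statements. [folklore] -/
theorem AtomisticToContinuum_iff :
    AtomisticToContinuum ↔
      Literature.MathematicalPhysics.KineticTheory.HydroLimitInBandDim 3 ∧ Literature.MathematicalPhysics.KineticTheory.HeatConduction.FouriersLaw ∧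
        Literature.MathematicalPhysics.StatisticalMechanics.Crystallization ∧ Literature.MathematicalPhysics.QuantumManyBody.BoseGas.BoseEinsteinCondensation :=
  and_congr_left' hydroLimitInBandDim_three_iff_root.symm
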